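import Summits.CriticalPhenomena.PercolationContinuityZ3.Theorems.PercNearOneGluingNoHeavyLowerTailSahiHardCoreReduction
import Summits.CriticalPhenomena.PercolationContinuityZ3.Theorems.PercNearOneGluingNoHeavyLowerTailSahiE3DepthOneEvents
import Literature.Combinatorics.Sahi2008.Percolation
import HarnessLib

/-!
# `NoHeavyLowerTail` (stmt-CriticalPhenomena-4575) — SAHI POSITIVITY AT EVERY ORDER for hitting families of WIDTH ≤ 3

Support file, seat `prim-l12-p5` (gen 7), `--supports stmt-CriticalPhenomena-4575`.  No definitions, no named facts, no sorries,
standard axioms (the width-4 strengthening, which needs the kernel certificate of the hitting `C₄`, is the companion file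
`…SahiHittingWidthFour`).

Setting (Kahn's): the product Bernoulli weight `bernoulliWeight p` on `2^ι` (`ι` finite) and HITTING EVENTS
`H_A = {ω | ∃ a ∈ A, a ∈ ω}` ("some coordinate of `A` is open") for an arbitrary indexed family of finite sets
`A : Fin m → Finset ι` (repetitions allowed).  The seat proved Sahi's `C₃` for three hitting events on any product space
(`SahiHitting.prodBernoulli_sahiE3_hit_nonneg`, gen 6, closed seven-region form).  Here: **every order `m`**, for families of sets
of small WIDTH (size of the largest `⊆`-antichain among the `A_k`, equal sets counting as comparable).

* `hit_absorbs_of_subset`: a nested pair `A i ⊆ A j` inside a sub-family makes it meet-absorbing (`H_{A_j} ⊇ H_{A_i} ⊇ ⋂`).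
  (For hitting events this is also necessary — `⋂_{l≠q} H_{A_l} ⊆ H_{A_q}` iff some `A_l ⊆ A_q`, a transversal of the
  `A_l ∖ A_q` witnessing the failure otherwise — so "(k+1)-wise absorbing" is exactly "width ≤ k"; only sufficiency is used.)
* `prodBernoulli_sahiE_hit_nonneg_of_nested` (the reduction, any `k ≥ 1`): if every nonempty sub-family of size `≤ k` has
  `E ≥ 0` and among any `k + 1` indices two carry nested sets, then `E_m ≥ 0` — Theorem G′ of the lane
  (`SahiHereditaryMeetAbsorption.sahiE_nonneg_of_small_of_absorbing`) specialised to hitting families.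
* `sahiE_hit_subfamily_nonneg_of_card_le_three`: sub-families of size ≤ 3 of a hitting family are nonnegative (FKG for pairs,
  the hitting `C₃` for triples).
* **`prodBernoulli_sahiE_hit_nonneg_of_width_le_three`** (main): if among ANY FOUR indices two carry nested sets, then
  `0 ≤ E_m(1_{H_{A_0}}, …, 1_{H_{A_{m−1}}})` for every `m`.
* Corollaries: at most three distinct sets with ARBITRARY MULTIPLICITIES (`…_of_three_sets`, pigeonhole) — in particular
  `E_m(H_A^{×a}, H_B^{×b}, H_C^{×c}) ≥ 0` for all finite `A, B, C ⊆ ι`, i.e. Sahi's generating-function Conjecture 4 /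
  Lieb–Sahi 1.2 for three hitting events (this particular corollary is also covered, with comb positivity, by the `prim-masterthm`
  lane's `SahiCombDisjunct.combAllOrders_orFamily_three`; the width-3 theorem itself — arbitrary families, any number of distinct
  sets — is new) — `⊆`-chains of sets of any length (`…_of_chain`), and the DECREASING forms `{ω | ∃ a ∈ A_k, a ∉ ω}` ("some
  coordinate of `A_k` closed") by the reflection `ω ↦ ωᶜ`, `q ↦ 1 − q` at every order (`sahiE_someClosed_eq_sahiE_hit`).

LOCALITY IN WIDTH.  By Theorem G′ the same argument gives: Sahi's `C_1, …, C_k` for ALL hitting families ⟺ every-order positivity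
for hitting families of width ≤ `k` (a `k`-slot family has width ≤ `k`).  What remains open for hitting events ("Conjecture Q-OR" of the
seat = `OR(∞)` of the `prim-masterthm` hierarchy): `C_5` — five pairwise `⊆`-incomparable sets.
-/

namespace Summit.CriticalPhenomena.PercolationContinuityZ3.Theorems

namespace SahiHitting

open Finset Function Literature.Combinatorics.Sahi2008 SahiMomentExpansion SahiHereditaryMeetAbsorption
open Literature.Probability.Percolation.DecisionTree (ind ind_of_mem ind_of_not_mem ind_nonneg)
open Literature.Probability.LatticeModels (prodBernoulli sahiE3)

variable {ι : Type*}

/-- A nested pair `A i ⊆ A j` (`i ≠ j`) inside a sub-family `S` of hitting events makes `S` meet-absorbing: the hitting event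
of the larger set contains the hitting event of the smaller one, hence the intersection of all the others. [this work] -/
theorem hit_absorbs_of_subset {m : ℕ} (A : Fin m → Finset ι) (S : Finset (Fin m)) {i j : Fin m} (hi : i ∈ S) (hj : j ∈ S)
    (hij : i ≠ j) (hsub : A i ⊆ A j) :
    ∃ q ∈ S, ∀ ω : Set ι, (∀ l ∈ S.erase q, ω ∈ {ω : Set ι | ∃ a ∈ A l, a ∈ ω}) → ω ∈ {ω : Set ι | ∃ a ∈ A q, a ∈ ω} := by
  refine ⟨j, hj, fun ω hω => ?_⟩
  obtain ⟨a, ha, haω⟩ := hω i (Finset.mem_erase.mpr ⟨hij, hi⟩)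
  exact ⟨a, hsub ha, haω⟩

/-- The indicator of a hitting event is at most one. [folklore] -/
theorem ind_hit_le_one (A : Finset ι) (ω : Set ι) : ind {ω : Set ι | ∃ a ∈ A, a ∈ ω} ω ≤ 1 := by
  by_cases h : ω ∈ {ω : Set ι | ∃ a ∈ A, a ∈ ω}
  · rw [ind_of_mem h]
  · rw [ind_of_not_mem h]; exact zero_le_one

variable [Fintype ι]

/-- **The reduction (any `k ≥ 1`).**  If every nonempty sub-family of size `≤ k` of the hitting family has `E ≥ 0` and among any
`k + 1` indices two carry nested sets, then `E_m ≥ 0`: Theorem G′ with `(k+1)`-wise absorption supplied by the nested pairs.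
[this work] -/
theorem prodBernoulli_sahiE_hit_nonneg_of_nested (p : ι → unitInterval) {k : ℕ} (hk : 1 ≤ k) (m : ℕ) (A : Fin m → Finset ι)
    (hsmall : ∀ S : Finset (Fin m), S.Nonempty → S.card ≤ k →
      0 ≤ sahiE (bernoulliWeight p) S.card (fun j => ind {ω : Set ι | ∃ a ∈ A (S.orderEmbOfFin rfl j), a ∈ ω}))
    (hw : ∀ S : Finset (Fin m), S.card = k + 1 → ∃ i ∈ S, ∃ j ∈ S, i ≠ j ∧ A i ⊆ A j) :
    0 ≤ sahiE (bernoulliWeight p) m (fun l => ind {ω : Set ι | ∃ a ∈ A l, a ∈ ω}) := by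
  have hμ := isFKGMeasure_bernoulliWeight p
  refine sahiE_nonneg_of_small_of_absorbing hμ.nonneg hμ.sum_eq_one hk m _ (fun l ω => ind_nonneg _ _)
    (fun l ω => ind_hit_le_one (A l) ω) hsmall ?_
  intro S hS
  refine exists_absorber_of_cardwise _ (fun T hT => ?_) S hS
  obtain ⟨i, hi, j, hj, hij, hsub⟩ := hw T hT
  exact exists_absorber_ind (fun l => {ω : Set ι | ∃ a ∈ A l, a ∈ ω}) T (hit_absorbs_of_subset A T hi hj hij hsub)

/-- Sub-families of size `≤ 3` of a hitting family are nonnegative: `E_1 = μ(H) ≥ 0`, `E_2 = Cov ≥ 0` (Harris/FKG), and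
`E_3 ≥ 0` by the hitting `C₃` of the seat (`prodBernoulli_sahiE3_hit_nonneg`). [this work] -/
theorem sahiE_hit_subfamily_nonneg_of_card_le_three (p : ι → unitInterval) {m : ℕ} (A : Fin m → Finset ι)
    (S : Finset (Fin m)) (hSne : S.Nonempty) (hS3 : S.card ≤ 3) :
    0 ≤ sahiE (bernoulliWeight p) S.card (fun j => ind {ω : Set ι | ∃ a ∈ A (S.orderEmbOfFin rfl j), a ∈ ω}) := by
  classical
  set g : Fin m → Set ι → ℝ := fun l => ind {ω : Set ι | ∃ a ∈ A l, a ∈ ω} with hg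
  have hμ := isFKGMeasure_bernoulliWeight p
  have hg0 : ∀ l ω, 0 ≤ g l ω := fun l ω => ind_nonneg _ _
  have hmono : ∀ l, Monotone (g l) := fun l => monotone_ind_of_isUpperSet (isUpperSet_hit (A l))
  change 0 ≤ sahiE (bernoulliWeight p) S.card (fun j => g (S.orderEmbOfFin rfl j))
  have hS1 : 1 ≤ S.card := Finset.card_pos.mpr hSne
  rcases (show S.card = 1 ∨ S.card = 2 ∨ S.card = 3 by omega) with h1 | h2 | h3
  · rw [← sahiE_cast _ h1.symm, sahiE_one_apply]
    exact ex_nonneg hμ.nonneg (hg0 _)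
  · rw [← sahiE_cast _ h2.symm, sahiE_two_apply, sub_nonneg]
    exact ex_mul_ex_le_ex_mul hμ (hg0 _) (hg0 _) (hmono _) (hmono _)
  · rw [subfamily_three_eq _ g S h3]
    simp only [hg]
    rw [sahiE_three_ind]
    exact prodBernoulli_sahiE3_hit_nonneg p _ _ _

/-- **Sahi positivity at every order for hitting families of width ≤ 3.**  If among any four indices two carry nested sets
(`A i ⊆ A j`; equal sets count), then `0 ≤ E_m(1_{H_{A_0}}, …, 1_{H_{A_{m−1}}})` for every `m`, on every finite product
space.  Inputs: FKG (pairs), the hitting `C₃` (triples), Theorem G′ (fourwise absorption). [this work] -/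
theorem prodBernoulli_sahiE_hit_nonneg_of_width_le_three (p : ι → unitInterval) (m : ℕ) (A : Fin m → Finset ι)
    (hw : ∀ S : Finset (Fin m), S.card = 4 → ∃ i ∈ S, ∃ j ∈ S, i ≠ j ∧ A i ⊆ A j) :
    0 ≤ sahiE (bernoulliWeight p) m (fun l => ind {ω : Set ι | ∃ a ∈ A l, a ∈ ω}) :=
  prodBernoulli_sahiE_hit_nonneg_of_nested p (by norm_num : 1 ≤ 3) m A
    (fun S hSne hS3 => sahiE_hit_subfamily_nonneg_of_card_le_three p A S hSne hS3) hw

/-- **At most three distinct sets, arbitrary multiplicities.**  For finite `B_0, B_1, B_2 ⊆ ι` and any assignment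
`c : Fin m → Fin 3` of slots to sets, `0 ≤ E_m(1_{H_{B_{c 0}}}, …, 1_{H_{B_{c (m−1)}}})` (pigeonhole: among four slots two
get the same set).  Equivalently: every coefficient of Sahi's generating function of three hitting events is nonnegative.
[this work] -/
theorem prodBernoulli_sahiE_hit_nonneg_of_three_sets (p : ι → unitInterval) (B : Fin 3 → Finset ι) (m : ℕ)
    (c : Fin m → Fin 3) :
    0 ≤ sahiE (bernoulliWeight p) m (fun l => ind {ω : Set ι | ∃ a ∈ B (c l), a ∈ ω}) := by
  refine prodBernoulli_sahiE_hit_nonneg_of_width_le_three p m (fun l => B (c l)) fun S hS => ?_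
  have hlt : (Finset.univ : Finset (Fin 3)).card < S.card := by simp [hS]
  obtain ⟨i, hi, j, hj, hij, hc⟩ := Finset.exists_ne_map_eq_of_card_lt_of_maps_to hlt (f := c) fun _ _ => Finset.mem_univ _
  exact ⟨i, hi, j, hj, hij, by simp [hc]⟩

/-- **Chains of sets, any length, every order.**  If the sets are totally ordered by inclusion along the index (`A` monotone),
then `E_m ≥ 0`. [this work] -/
theorem prodBernoulli_sahiE_hit_nonneg_of_chain (p : ι → unitInterval) (m : ℕ) (A : Fin m → Finset ι) (hA : Monotone A) :
    0 ≤ sahiE (bernoulliWeight p) m (fun l => ind {ω : Set ι | ∃ a ∈ A l, a ∈ ω}) := by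
  refine prodBernoulli_sahiE_hit_nonneg_of_width_le_three p m A fun S hS => ?_
  obtain ⟨i, hi, j, hj, hij⟩ := Finset.one_lt_card.mp (by omega : 1 < S.card)
  rcases lt_or_gt_of_ne hij with h | h
  · exact ⟨i, hi, j, hj, hij, hA h.le⟩
  · exact ⟨j, hj, i, hi, hij.symm, hA h.le⟩

/-! ### Decreasing form: "some coordinate of `A` is CLOSED" -/

/-- The product weight reflected: `μ_q(ωᶜ) = μ_{1−q}(ω)`. [cite: LiebSahi2021, footnote 2 (order reversal); Sahi2008, eq. (2)] -/
theorem bernoulliWeight_compl (q : ι → unitInterval) (ω : Set ι) :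
    bernoulliWeight q ωᶜ = bernoulliWeight (fun i => unitInterval.symm (q i)) ω := by
  classical
  simp only [bernoulliWeight, Literature.Probability.Percolation.BHK2006.weight, unitInterval.coe_symm_eq, Set.mem_compl_iff]
  refine Finset.prod_congr rfl fun i _ => ?_
  by_cases h : i ∈ ω <;> simp [h]

/-- Reflection at every order: Sahi's functional of the events "some coordinate of `A_l` is closed" under `μ_q` equals the
functional of the hitting events under the reflected weight `μ_{1−q}` (`ω ↦ ωᶜ` is a bijection of `2^ι` exchanging the two
weights and the two families). [this work] -/
theorem sahiE_someClosed_eq_sahiE_hit (q : ι → unitInterval) (m : ℕ) (A : Fin m → Finset ι) :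
    sahiE (bernoulliWeight q) m (fun l => ind {ω : Set ι | ∃ a ∈ A l, a ∉ ω})
      = sahiE (bernoulliWeight (fun i => unitInterval.symm (q i))) m (fun l => ind {ω : Set ι | ∃ a ∈ A l, a ∈ ω}) := by
  classical
  let e : Set ι ≃ Set ι := Function.Involutive.toPerm (compl : Set ι → Set ι) compl_compl
  have he : ∀ ω : Set ι, e ω = ωᶜ := fun ω => rfl
  have hμ : (bernoulliWeight q) ∘ e = bernoulliWeight (fun i => unitInterval.symm (q i)) := by
    funext ω
    rw [Function.comp_apply, he, bernoulliWeight_compl]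
  have hf : (fun l => (ind {ω : Set ι | ∃ a ∈ A l, a ∉ ω}) ∘ e)
      = fun l => ind {ω : Set ι | ∃ a ∈ A l, a ∈ ω} := by
    funext l ω
    rw [Function.comp_apply, he]
    by_cases h : ∃ a ∈ A l, a ∈ ω
    · rw [ind_of_mem (show ω ∈ {ω : Set ι | ∃ a ∈ A l, a ∈ ω} from h),
        ind_of_mem (show ωᶜ ∈ {ω : Set ι | ∃ a ∈ A l, a ∉ ω} from by
          obtain ⟨a, ha, haω⟩ := h; exact ⟨a, ha, fun hc => hc haω⟩)]
    · rw [ind_of_not_mem (show ω ∉ {ω : Set ι | ∃ a ∈ A l, a ∈ ω} from h),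
        ind_of_not_mem (show ωᶜ ∉ {ω : Set ι | ∃ a ∈ A l, a ∉ ω} from by
          rintro ⟨a, ha, haω⟩; exact h ⟨a, ha, not_not.mp haω⟩)]
  have key := sahiE_comp_equiv e (bernoulliWeight q) m (fun l => ind {ω : Set ι | ∃ a ∈ A l, a ∉ ω})
  rw [hμ, hf] at key
  exact key.symm

/-- **Decreasing form, width ≤ 3, every order.**  For the events `D_{A_k} = {ω | ∃ a ∈ A_k, a ∉ ω}` ("some coordinate of `A_k`
is closed" — complements of the cylinders `{A_k ⊆ ω}`; e.g. "some edge of `F_k` is closed" in bond percolation on a finite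
graph): if among any four indices two carry nested sets, then `0 ≤ E_m(1_{D_{A_0}}, …, 1_{D_{A_{m−1}}})` for every product
weight and every `m`. [this work] -/
theorem prodBernoulli_sahiE_someClosed_nonneg_of_width_le_three (q : ι → unitInterval) (m : ℕ) (A : Fin m → Finset ι)
    (hw : ∀ S : Finset (Fin m), S.card = 4 → ∃ i ∈ S, ∃ j ∈ S, i ≠ j ∧ A i ⊆ A j) :
    0 ≤ sahiE (bernoulliWeight q) m (fun l => ind {ω : Set ι | ∃ a ∈ A l, a ∉ ω}) := by
  rw [sahiE_someClosed_eq_sahiE_hit]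
  exact prodBernoulli_sahiE_hit_nonneg_of_width_le_three _ m A hw

end SahiHitting

end Summit.CriticalPhenomena.PercolationContinuityZ3.Theorems
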